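import Literature.Computability.Cryptography.ShorDiscreteLogPostModel
import Literature.Computability.Cryptography.ShorModExpBlock
import Literature.Computability.Cryptography.ShorPerfectPowerFP
import Literature.Computability.Complexity.PlumbingBricks
import Literature.Computability.Complexity.HashBricks
import Literature.Computability.Complexity.FPStringBricks
import Literature.Computability.Complexity.StackBricksStrings
import HarnessLib

/-!
# Kitaev's discrete-logarithm family: the double modular-exponentiation block function and block

Family `PQC` (trunk `CryptoQuantFine`); the classical *programming* half of the named fact
`Kitaev1995_dlogFamily` of `ShorDiscreteLogQuantum.lean` (Shor 1997, §6, p. 16: the third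
register holds `g^a x^{-b} mod p`, computed by the reversible modular exponentiation of §3;
Kitaev 1995, §4, p. 15: eigenvalue measurements of the two commuting permutations "multiply by
`g`" and "multiply by `y`" on shared target registers). The discrete-logarithm twin of
`ShorModExpProgram.lean` (`ModExpBlock.blockFn`, one generator), written in the brick algebra of
`FP` string functions (`BrickAlgebra.lean`) rather than as one structured stack program.

The function `blockFnD` reads the content of the data wires of Kitaev's circuit — the instance
`w = ⟨p, ⟨g, y⟩⟩` (`|w| = ℓ`) followed by the `dlNumControls ℓ = 4 · 2 · (ℓ+1) · 2B` control bits
`c`, generator-trial by generator-trial (`u = 2t + η`: trial `t < 4`, generator `η`: `g` then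
`y`), level by level (`l ≤ ℓ`), two windows of `B = 12288 (ℓ+1)` bits per level — with **no
delimiter**: the instance length `ℓ` is recovered from the total length `ℓ + dlNumControls ℓ`,
which is increasing in `ℓ` (`searchDF`). It outputs the coded list of the four residues
`(g^{E_{2t}} mod p) (y^{E_{2t+1}} mod p) mod p`, `E_u = ∑_l 2^l · #{ones of c in level l of u}`
(`ModExpBlock.levelExp`), each power computed by one modular exponentiation
`(b^{2^l})^{#ones}` per level and one squaring (Shor 1997, §3, p. 9: repeated squaring; the
arithmetic bricks `modExpFn`, `prodFn`, `remFn` of `StackBricksArith.lean`):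

* `lenPoly`, `searchRoundD`, `searchDF`, `searchF_wellFormed` — the instance length from the total
  length;
* `lvBodyD`, `lvLoopD` (a counted loop, `Brick.loopFn_mem_FP`), `loopModel_lvBody` — the level
  loop and its invariant `r = r₀ · P₀^{levelExp}`, `P = P₀^{2^j}` modulo `p`;
* `powDF`, `resTDF`, `outDF`, **`blockFnD`**, **`blockFn_mem_FP`**, and **`blockFn_wellFormed`**: on
  `encodeDLogInstance p g y ++ c` (`p ≥ 2`, `|c| = dlNumControls ℓ`) the output is
  `encList [residueD 0, residueD 1, residueD 2, residueD 3]`.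

Then, after `ShorModExpBlock.lean` (whose generic lemmas `liftW_tri`, `liftW_coinInput`,
`levelExp_eq_sum`, `sum_fin_two_mul`, `encList_injective` are reused): the block machine `MD`,
the layout (`dataND ℓ = ℓ + dlNumControls ℓ` data wires, no suffix, `mWD ℓ` work wires), **the block
`VD ℓ`** = the exact Clifford+T compilation (`revCompile`) of Bennett's compute–copy–uncompute
block `RevClean.cleanOps` of `MD`; its semantics `VB_mulVec_basisState`
(`VD |w⟩|c⟩|0⟩ = |w⟩|c⟩|resOfD w c⟩`); the layout identity `trialExp_eq_expo` (Kitaev's weighted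
trial exponents of tag `(t, η)` are the Horner sums of generator-trial `2t + η`);
`resOf_eq_iff` (the work register determines and is determined by the residues
`g^{A_t} y^{B_t} mod p`); the remaining named programming fact `kitaevDLogBlockFamily_isUniform`
and **`Kitaev1995_dlogFamily_of : kitaevDLogBlockFamily_isUniform → Kitaev1995_dlogFamily`**.

## References

* P. W. Shor, *Polynomial-time algorithms for prime factorization and discrete logarithms on a
  quantum computer*, SIAM J. Comput. 26 (1997) 1484–1509, §3 (pp. 8–10 of arXiv:quant-ph/9508027v2:
  reversible modular exponentiation by repeated squaring), §6 (p. 16: the register `g^a x^{-b} mod p`).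
* A. Yu. Kitaev, *Quantum measurements and the Abelian Stabilizer Problem*, arXiv:quant-ph/9511026
  (1995), §4 p. 15 (two generators on shared registers).
* S. Arora, B. Barak, *Computational Complexity: A Modern Approach*, CUP 2009, §1.3 (closure of
  polynomial time under composition and bounded loops).
-/

noncomputable section

namespace Literature.Computability.Cryptography

namespace Kitaev1995

namespace DLogBlock

open _root_.Computability Polynomial Complexity Complexity.Brick Complexity.Plumb
  Complexity.HashBricks Complexity.PRelSigma ShorFP ModExpBlock

/-! ### Sizes as polynomials of the instance length -/

/-- The width of the two windows of a level: `2B = 2 · 12288 (ℓ+1)`. [folklore] -/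
def win2Poly : Polynomial ℕ := C 2 * (C 12288 * (X + 1))

/-- `win2Poly` evaluates to `2 · dlBlockSize`. [folklore] -/
theorem win2Poly_eval (ℓ : ℕ) : win2Poly.eval ℓ = 2 * dlBlockSize ℓ := by
  simp only [win2Poly, eval_mul, eval_C, eval_add, eval_X, eval_one, dlBlockSize, dlNumLevels]

/-- The number of control bits of one generator-trial: `2B (ℓ+1)`. [folklore] -/
def genLenD (ℓ : ℕ) : ℕ := 2 * dlBlockSize ℓ * dlNumLevels ℓ

/-- `genLenD` as a polynomial. [folklore] -/
def genPoly : Polynomial ℕ := win2Poly * (X + 1)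

/-- `genPoly` evaluates to `genLenD`. [folklore] -/
theorem genPoly_eval (ℓ : ℕ) : genPoly.eval ℓ = genLenD ℓ := by
  rw [genPoly, eval_mul, win2Poly_eval, eval_add, eval_X, eval_one]; rfl

/-- The total data length `ℓ + dlNumControls ℓ` as a polynomial of `ℓ`. [folklore] -/
def lenPoly : Polynomial ℕ := X + C 4 * (C 2 * ((X + 1) * win2Poly))

/-- `lenPoly` evaluates to the data length. [folklore] -/
theorem lenPoly_eval (ℓ : ℕ) : lenPoly.eval ℓ = ℓ + dlNumControls ℓ := by
  rw [lenPoly, eval_add, eval_X, eval_mul, eval_C, eval_mul, eval_C, eval_mul, eval_add, eval_X, eval_one, win2Poly_eval]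
  rfl

/-- `dlNumControls` is `4` generator-trial pairs. [folklore] -/
theorem dlNumControls_eq (ℓ : ℕ) : dlNumControls ℓ = 8 * genLenD ℓ := by
  unfold dlNumControls genLenD numTrials; ring

/-- The data length is increasing in `ℓ`. [folklore] -/
theorem dataLen_strictMono : StrictMono fun ℓ => ℓ + dlNumControls ℓ := by
  refine strictMono_nat_of_lt_succ fun ℓ => ?_
  have : dlNumControls ℓ ≤ dlNumControls (ℓ + 1) := by
    unfold dlNumControls dlBlockSize dlNumLevels numTrials
    gcongr <;> omega
  show ℓ + dlNumControls ℓ < ℓ + 1 + dlNumControls (ℓ + 1)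
  omega

/-! ### The instance length from the total length -/

/-- **One round of the length search** on `⟨z, ⟨cand, done⟩⟩` (`cand = 1^j`): once `done`, idle;
else stop if `|z| ≤ j + dlNumControls j`, otherwise `j := j + 1`. [folklore] -/
def searchRoundD : List Bool → List Bool :=
  fanoutFn fstF (iteFn (headBitFn ∘ sndPow 1) sndF
    (iteFn (lenLeFn lenPoly ∘ fanoutFn (nthF 1) fstF) (fanoutFn (nthF 1) (fun _ => [true]))
      (fanoutFn (List.cons true ∘ nthF 1) (fun _ => []))))

/-- `searchRoundD ∈ FP`. [folklore] -/
theorem searchRound_mem_FP : searchRoundD ∈ FP :=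
  fanoutFn_mem_FP fstF_mem_FP (iteFn_mem_FP (comp_mem_FP headBitFn_mem_FP (sndPow_mem_FP 1)) sndF_mem_FP
    (iteFn_mem_FP (comp_mem_FP (lenLeFn_mem_FP _) (fanoutFn_mem_FP (nthF_mem_FP 1) fstF_mem_FP))
      (fanoutFn_mem_FP (nthF_mem_FP 1) (const_mem_FP _))
      (fanoutFn_mem_FP (comp_mem_FP (cons_mem_FP true) (nthF_mem_FP 1)) (const_mem_FP _))))

/-- A finished search idles. [folklore] -/
theorem searchRound_done (z cand : List Bool) :
    searchRoundD (boolPair z (boolPair cand [true])) = boolPair z (boolPair cand [true]) := by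
  rw [searchRoundD, fanoutFn_apply, fstF_boolPair, iteFn_apply_true (by simp)]
  simp

/-- A running search tests the candidate. [folklore] -/
theorem searchRound_run (z : List Bool) (j : ℕ) :
    searchRoundD (boolPair z (boolPair (ones j) [])) =
      if z.length ≤ j + dlNumControls j then boolPair z (boolPair (ones j) [true])
      else boolPair z (boolPair (ones (j + 1)) []) := by
  rw [searchRoundD, fanoutFn_apply, fstF_boolPair, iteFn_apply_false (by simp)]
  have hc : (lenLeFn lenPoly ∘ fanoutFn (nthF 1) fstF) (boolPair z (boolPair (ones j) [])) =
      [decide (z.length ≤ j + dlNumControls j)] := by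
    simp [lenLeFn_boolPair, lenPoly_eval]
  by_cases h : z.length ≤ j + dlNumControls j
  · rw [iteFn_apply_true (by rw [hc, decide_eq_true h]), if_pos h]; simp
  · rw [iteFn_apply_false (by rw [hc, decide_eq_false h]), if_neg h]; simp [ones, List.replicate_succ]

/-- `searchRoundD` lengthens no input by more than `6`. [folklore] -/
theorem length_searchRound_le (r : List Bool) : (searchRoundD r).length ≤ r.length + 6 := by
  have h0 := length_fstF_sndF_le r
  have h1 := length_nthF_succ_add_sndPow_succ_le 0 r
  rw [Nat.zero_add, sndPow_zero] at h1
  rw [searchRoundD, fanoutFn_apply, length_boolPair, iteFn_of_oneBit (oneBit_headBitFn.comp _)]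
  split_ifs
  · omega
  · have hob : OneBit (lenLeFn lenPoly ∘ fanoutFn (nthF 1) fstF) := fun w =>
      (lenLeFn_eq_or lenPoly (fanoutFn (nthF 1) fstF w)).elim (fun h => ⟨_, h⟩) fun h => ⟨_, h⟩
    rw [iteFn_of_oneBit hob]
    split_ifs
    · simp only [fanoutFn_apply, length_boolPair, List.length_cons, List.length_nil]; omega
    · simp only [fanoutFn_apply, length_boolPair, Function.comp_apply, List.length_cons, List.length_nil]; omega

/-- Rounds of a running search below the instance length. [folklore] -/
theorem iterate_searchRound_lt (z : List Bool) {ℓ : ℕ} (hz : z.length = ℓ + dlNumControls ℓ) :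
    ∀ j, j ≤ ℓ → searchRoundD^[j] (boolPair z (boolPair [] [])) = boolPair z (boolPair (ones j) [])
  | 0, _ => rfl
  | j + 1, hj => by
    rw [Function.iterate_succ_apply', iterate_searchRound_lt z hz j (by omega), searchRound_run, if_neg]
    rw [hz, not_le]
    exact dataLen_strictMono (show j < ℓ by omega)

/-- **The length search**: `|z| + 1` rounds from `⟨z, ⟨ε, ε⟩⟩`, then the candidate. [folklore] -/
def searchDF : List Bool → List Bool :=
  nthF 1 ∘ (fun q => searchRoundD^[(X + 1 : Polynomial ℕ).eval (boolUnpair q).1.length] q) ∘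
    fanoutFn idF (fanoutFn (fun _ => []) (fun _ => []))

/-- `searchDF ∈ FP`. [cite: AroraBarak2009, §1.3 (bounded loops)] -/
theorem searchF_mem_FP : searchDF ∈ FP :=
  comp_mem_FP (nthF_mem_FP 1) (comp_mem_FP (iterate_mem_FP searchRound_mem_FP 6 length_searchRound_le (X + 1))
    (fanoutFn_mem_FP idF_mem_FP (fanoutFn_mem_FP (const_mem_FP _) (const_mem_FP _))))

/-- **The search finds the instance length** of a well-formed data string. [folklore] -/
theorem searchF_wellFormed (z : List Bool) {ℓ : ℕ} (hz : z.length = ℓ + dlNumControls ℓ) : searchDF z = ones ℓ := by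
  have hle : ℓ + 1 ≤ z.length + 1 := by rw [hz]; omega
  obtain ⟨d, hd⟩ := Nat.exists_eq_add_of_le hle
  have hstop : searchRoundD^[ℓ + 1] (boolPair z (boolPair [] [])) = boolPair z (boolPair (ones ℓ) [true]) := by
    rw [Function.iterate_succ_apply', iterate_searchRound_lt z hz ℓ le_rfl, searchRound_run, if_pos (by rw [hz])]
  simp only [searchDF, Function.comp_apply, fanoutFn_apply, idF, boolUnpair_boolPair, eval_add, eval_X, eval_one]
  rw [hd, Nat.add_comm, Function.iterate_add_apply, hstop, Function.iterate_fixed (searchRound_done z (ones ℓ))]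
  simp

/-! ### The parsed input `⟨1^ℓ, z⟩` and its fields -/

/-- The parsed input record `⟨1^ℓ, z⟩`. [folklore] -/
def precD (ℓ : ℕ) (z : List Bool) : List Bool := boolPair (ones ℓ) z

/-- The instance `w = z ↾ ℓ`. [folklore] -/
def wDF : List Bool → List Bool := takeFn
/-- The controls `c = z ⇂ ℓ`. [folklore] -/
def cDF : List Bool → List Bool := dropFn
/-- The modulus numeral `p`. [folklore] -/
def pDF : List Bool → List Bool := fstF ∘ wDF
/-- The numeral of the primitive root `g`. [folklore] -/
def gDF : List Bool → List Bool := nthF 1 ∘ wDF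
/-- The numeral of the element `y`. [folklore] -/
def yDF : List Bool → List Bool := sndPow 1 ∘ wDF
/-- The controls of generator-trial `u`: `c ⇂ (u · genLenD ℓ)`. [folklore] -/
def segUDF (u : ℕ) : List Bool → List Bool := dropFn ∘ fanoutFn (onesMulFn u ∘ polyFn genPoly ∘ fstF) cDF

/-- `wF_mem_FP`: membership in `FP`. [folklore] -/
theorem wF_mem_FP : wDF ∈ FP := takeFn_mem_FP
/-- `cF_mem_FP`: membership in `FP`. [folklore] -/
theorem cF_mem_FP : cDF ∈ FP := dropFn_mem_FP
/-- `pF_mem_FP`: membership in `FP`. [folklore] -/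
theorem pF_mem_FP : pDF ∈ FP := comp_mem_FP fstF_mem_FP wF_mem_FP
/-- `gF_mem_FP`: membership in `FP`. [folklore] -/
theorem gF_mem_FP : gDF ∈ FP := comp_mem_FP (nthF_mem_FP 1) wF_mem_FP
/-- `yF_mem_FP`: membership in `FP`. [folklore] -/
theorem yF_mem_FP : yDF ∈ FP := comp_mem_FP (sndPow_mem_FP 1) wF_mem_FP
/-- `segUF_mem_FP`: membership in `FP`. [folklore] -/
theorem segUF_mem_FP (u : ℕ) : segUDF u ∈ FP :=
  comp_mem_FP dropFn_mem_FP (fanoutFn_mem_FP (comp_mem_FP (onesMulFn_mem_FP u) (comp_mem_FP (polyFn_mem_FP _) fstF_mem_FP))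
    cF_mem_FP)

section precValue

variable (p g y : ℕ) (c : List Bool)

/-- The instance string is the nested pair of the three numerals. [folklore] -/
theorem encodeDLogInstance_eq_boolPair : (encodeDLogInstance p g y) = boolPair (encodeNat p) (boolPair (encodeNat g) (encodeNat y)) := rfl

/-- `wF_prec`: evaluation rule on the parsed input. [folklore] -/
@[simp] theorem wF_prec : wDF (precD (encodeDLogInstance p g y).length ((encodeDLogInstance p g y) ++ c)) = (encodeDLogInstance p g y) := by simp [wDF, precD]
/-- `cF_prec`: evaluation rule on the parsed input. [folklore] -/
@[simp] theorem cF_prec : cDF (precD (encodeDLogInstance p g y).length ((encodeDLogInstance p g y) ++ c)) = c := by simp [cDF, precD]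
/-- `pF_prec`: evaluation rule on the parsed input. [folklore] -/
@[simp] theorem pF_prec : pDF (precD (encodeDLogInstance p g y).length ((encodeDLogInstance p g y) ++ c)) = encodeNat p := by
  rw [pDF, Function.comp_apply, wF_prec, encodeDLogInstance_eq_boolPair, fstF_boolPair]
/-- `gF_prec`: evaluation rule on the parsed input. [folklore] -/
@[simp] theorem gF_prec : gDF (precD (encodeDLogInstance p g y).length ((encodeDLogInstance p g y) ++ c)) = encodeNat g := by
  rw [gDF, Function.comp_apply, wF_prec, encodeDLogInstance_eq_boolPair]; simp
/-- `yF_prec`: evaluation rule on the parsed input. [folklore] -/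
@[simp] theorem yF_prec : yDF (precD (encodeDLogInstance p g y).length ((encodeDLogInstance p g y) ++ c)) = encodeNat y := by
  rw [yDF, Function.comp_apply, wF_prec, encodeDLogInstance_eq_boolPair]; simp
/-- `segUF_prec`: evaluation rule on the parsed input. [folklore] -/
@[simp] theorem segUF_prec (u : ℕ) : segUDF u (precD (encodeDLogInstance p g y).length ((encodeDLogInstance p g y) ++ c)) = c.drop (u * genLenD (encodeDLogInstance p g y).length) := by
  simp [segUDF, precD, onesMulFn, genPoly_eval, cDF]

end precValue

/-! ### The level loop: one modular exponentiation per level, one squaring -/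

/-- The clock-and-modulus field `x = ⟨1^ℓ, p⟩` of the level loop. [folklore] -/
def xDF : List Bool → List Bool := fanoutFn fstF pDF

/-- `xF_mem_FP`: membership in `FP`. [folklore] -/
theorem xF_mem_FP : xDF ∈ FP := fanoutFn_mem_FP fstF_mem_FP pF_mem_FP

/-- **The body of the level loop** on `⟨x, ⟨counter, ⟨rest, ⟨r, P⟩⟩⟩⟩`, `x = ⟨1^ℓ, p⟩`: with
`n = #{ones of the next 2B control bits}`, `r := r · (P^n mod p) mod p`, `P := P² mod p`, drop the
`2B` bits. [cite: Shor1997, §3 p.9 (modular exponentiation by repeated squaring)] -/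
def lvBodyD : List Bool → List Bool :=
  fanoutFn (dropFn ∘ fanoutFn (polyFn win2Poly ∘ fstF ∘ fstF) (nthF 2))
    (fanoutFn
      (remFn ∘ fanoutFn (prodFn ∘ fanoutFn (nthF 3)
        (modExpFn ∘ fanoutFn (sndPow 3) (fanoutFn (popCountFn ∘ takeFn ∘ fanoutFn (polyFn win2Poly ∘ fstF ∘ fstF) (nthF 2))
          (sndF ∘ fstF)))) (sndF ∘ fstF))
      (modExpFn ∘ fanoutFn (sndPow 3) (fanoutFn (fun _ => encodeNat 2) (sndF ∘ fstF))))

/-- `lvBodyD ∈ FP`. [folklore] -/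
theorem lvBody_mem_FP : lvBodyD ∈ FP :=
  fanoutFn_mem_FP (comp_mem_FP dropFn_mem_FP (fanoutFn_mem_FP
      (comp_mem_FP (polyFn_mem_FP _) (comp_mem_FP fstF_mem_FP fstF_mem_FP)) (nthF_mem_FP 2)))
    (fanoutFn_mem_FP
      (comp_mem_FP remFn_mem_FP (fanoutFn_mem_FP (comp_mem_FP prodFn_mem_FP (fanoutFn_mem_FP (nthF_mem_FP 3)
        (comp_mem_FP modExpFn_mem_FP (fanoutFn_mem_FP (sndPow_mem_FP 3) (fanoutFn_mem_FP
          (comp_mem_FP popCountFn_mem_FP (comp_mem_FP takeFn_mem_FP (fanoutFn_mem_FP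
            (comp_mem_FP (polyFn_mem_FP _) (comp_mem_FP fstF_mem_FP fstF_mem_FP)) (nthF_mem_FP 2))))
          (comp_mem_FP sndF_mem_FP fstF_mem_FP)))))) (comp_mem_FP sndF_mem_FP fstF_mem_FP)))
      (comp_mem_FP modExpFn_mem_FP (fanoutFn_mem_FP (sndPow_mem_FP 3) (fanoutFn_mem_FP (const_mem_FP _)
        (comp_mem_FP sndF_mem_FP fstF_mem_FP)))))

/-- **Value of the body of the level loop** (`p ≥ 2`). [cite: Shor1997, §3 p.9] -/
theorem lvBody_apply {p : ℕ} (hp : 2 ≤ p) (ℓ : ℕ) (cnt rest : List Bool) (r P : ℕ) :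
    lvBodyD (boolPair (boolPair (ones ℓ) (encodeNat p)) (boolPair cnt (boolPair rest (boolPair (encodeNat r) (encodeNat P))))) =
      boolPair (rest.drop (2 * dlBlockSize ℓ))
        (boolPair (encodeNat (r * (P ^ (rest.take (2 * dlBlockSize ℓ)).count true % p) % p)) (encodeNat (P ^ 2 % p))) := by
  have hp' : 2 ≤ bitsToNat (encodeNat p) := by rwa [bitsToNat_encodeNat]
  simp [lvBodyD, win2Poly_eval, modExpFn_boolPair hp']

/-- The values of the body are short: the remainder is below the modulus field, the power is a
modular exponentiation (empty for a modulus `≤ 1`). [folklore] -/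
theorem length_lvBody_le (z : List Bool) : (lvBodyD z).length ≤ (sndPow 1 z).length + 6 * ((fstF z).length + 1) := by
  have h0 := length_fstF_sndF_le z
  have h1 := length_nthF_succ_add_sndPow_succ_le 0 z
  have h2 := length_nthF_succ_add_sndPow_succ_le 1 z
  rw [Nat.zero_add, sndPow_zero] at h1
  have hx : (sndF (fstF z)).length ≤ (fstF z).length := by have := length_fstF_sndF_le (fstF z); omega
  -- a remainder by the field `snd x` is at most as long as that field (or the modulus is `0`)
  have hrem : ∀ a : ℕ, (encodeNat (a % bitsToNat (sndF (fstF z)))).length ≤ (fstF z).length ∨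
      bitsToNat (sndF (fstF z)) = 0 := by
    intro a
    rcases Nat.eq_zero_or_pos (bitsToNat (sndF (fstF z))) with h | h
    · exact Or.inr h
    · exact Or.inl (((length_encodeNat_mono (Nat.mod_lt _ h).le).trans (length_encodeNat_bitsToNat_le _)).trans hx)
  -- a modular exponentiation by that field is at most as long as it
  have hme : ∀ a e : List Bool, (modExpFn (boolPair a (boolPair e (sndF (fstF z))))).length ≤ (fstF z).length := by
    intro a e
    by_cases hm : 2 ≤ bitsToNat (sndF (fstF z))
    · rw [modExpFn_boolPair hm]
      exact ((length_encodeNat_mono (Nat.mod_lt _ (by omega)).le).trans (length_encodeNat_bitsToNat_le _)).trans hx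
    · rw [modExpFn_boolPair_of_le (by omega)]; exact Nat.zero_le _
  have hme0 : ∀ a e : List Bool, bitsToNat (sndF (fstF z)) = 0 → modExpFn (boolPair a (boolPair e (sndF (fstF z)))) = [] :=
    fun a e h => modExpFn_boolPair_of_le (by omega) a e
  rw [lvBodyD, fanoutFn_apply, fanoutFn_apply, length_boolPair, length_boolPair]
  have hrest : ((dropFn ∘ fanoutFn (polyFn win2Poly ∘ fstF ∘ fstF) (nthF 2)) z).length ≤ (nthF 2 z).length := by simp
  have hr : ((remFn ∘ fanoutFn (prodFn ∘ fanoutFn (nthF 3) (modExpFn ∘ fanoutFn (sndPow 3)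
      (fanoutFn (popCountFn ∘ takeFn ∘ fanoutFn (polyFn win2Poly ∘ fstF ∘ fstF) (nthF 2)) (sndF ∘ fstF)))) (sndF ∘ fstF)) z).length ≤
      (fstF z).length := by
    simp only [Function.comp_apply, fanoutFn_apply, remFn_boolPair, prodFn_boolPair, bitsToNat_encodeNat]
    rcases hrem (bitsToNat (nthF 3 z) * bitsToNat (modExpFn (boolPair (sndPow 3 z) (boolPair
      (popCountFn (takeFn (boolPair (polyFn win2Poly (fstF (fstF z))) (nthF 2 z)))) (sndF (fstF z)))))) with h | h
    · exact h
    · rw [hme0 _ _ h, h]; simp [show encodeNat 0 = [] from rfl]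
  have hP : ((modExpFn ∘ fanoutFn (sndPow 3) (fanoutFn (fun _ => encodeNat 2) (sndF ∘ fstF))) z).length ≤ (fstF z).length := by
    simp only [Function.comp_apply, fanoutFn_apply]; exact hme _ _
  norm_num at h2
  omega

/-- **The level loop** (counted, `ℓ + 1` rounds) started on `⟨x, ⟨ℓ+1, state₀⟩⟩`. [cite: Shor1997, §3 p.9] -/
def lvLoopD : List Bool → List Bool := fun z => (loopStep lvBodyD)^[(X : Polynomial ℕ).eval (fstF z).length] z

/-- `lvLoopD ∈ FP`. [cite: AroraBarak2009, §1.3 (bounded loops), §1.4.1] -/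
theorem lvLoopF_mem_FP : lvLoopD ∈ FP := loopFn_mem_FP lvBody_mem_FP length_lvBody_le X

/-- **Invariant of the level loop**: from `⟨rest, ⟨r mod p, P mod p⟩⟩`, `j` rounds give
`⟨rest ⇂ 2Bj, ⟨r · P^{levelExp 2B j rest} mod p, P^{2^j} mod p⟩⟩`. [cite: Shor1997, §3 p.9 (repeated squaring)] -/
theorem loopModel_lvBody {p : ℕ} (hp : 2 ≤ p) (ℓ : ℕ) : ∀ (j : ℕ) (rest : List Bool) (r P : ℕ),
    loopModel lvBodyD (boolPair (ones ℓ) (encodeNat p)) j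
        (boolPair rest (boolPair (encodeNat (r % p)) (encodeNat (P % p)))) =
      boolPair (rest.drop (2 * dlBlockSize ℓ * j))
        (boolPair (encodeNat (r * P ^ levelExp (2 * dlBlockSize ℓ) j rest % p)) (encodeNat (P ^ 2 ^ j % p)))
  | 0, rest, r, P => by simp [loopModel, levelExp]
  | j + 1, rest, r, P => by
    have e1 : r % p * ((P % p) ^ (rest.take (2 * dlBlockSize ℓ)).count true % p) % p =
        r * P ^ (rest.take (2 * dlBlockSize ℓ)).count true % p := by
      rw [← Nat.pow_mod, ← Nat.mul_mod]
    have e2 : (P % p) ^ 2 % p = P ^ 2 % p := (Nat.pow_mod P 2 p).symm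
    have e3 : r * P ^ (rest.take (2 * dlBlockSize ℓ)).count true *
        (P ^ 2) ^ levelExp (2 * dlBlockSize ℓ) j (rest.drop (2 * dlBlockSize ℓ)) =
        r * P ^ levelExp (2 * dlBlockSize ℓ) (j + 1) rest := by
      rw [levelExp, pow_add, pow_mul, ← pow_mul]; ring
    have e4 : (P ^ 2) ^ 2 ^ j = P ^ 2 ^ (j + 1) := by rw [← pow_mul, ← pow_succ']
    have e5 : 2 * dlBlockSize ℓ + 2 * dlBlockSize ℓ * j = 2 * dlBlockSize ℓ * (j + 1) := by ring
    rw [loopModel, lvBody_apply hp, e1, e2, loopModel_lvBody hp ℓ j, List.drop_drop, e3, e4, e5]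

/-! ### The residues -/

/-- **The power of one generator-trial**: `b^{E_u} mod p` for the base `b` (a field of the parsed
input) and the controls of generator-trial `u`: the `r`-field after the level loop started on
`⟨⟨1^ℓ, p⟩, ⟨ℓ+1, ⟨c ⇂ u·genLenD, ⟨1 mod p, b mod p⟩⟩⟩⟩`. [cite: Shor1997, §3 p.9; Kitaev1995, §4 p.15] -/
def powDF (u : ℕ) (b : List Bool → List Bool) : List Bool → List Bool :=
  nthF 3 ∘ lvLoopD ∘ fanoutFn xDF (fanoutFn (lenBinF ∘ List.cons true ∘ fstF)
    (fanoutFn (segUDF u) (fanoutFn (remFn ∘ fanoutFn (fun _ => [true]) pDF) (remFn ∘ fanoutFn b pDF))))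

/-- `powDF u b ∈ FP`. [folklore] -/
theorem powF_mem_FP (u : ℕ) {b : List Bool → List Bool} (hb : b ∈ FP) : powDF u b ∈ FP :=
  comp_mem_FP (nthF_mem_FP 3) (comp_mem_FP lvLoopF_mem_FP (fanoutFn_mem_FP xF_mem_FP (fanoutFn_mem_FP
    (comp_mem_FP lenBinF_mem_FP (comp_mem_FP (cons_mem_FP true) fstF_mem_FP))
    (fanoutFn_mem_FP (segUF_mem_FP u) (fanoutFn_mem_FP (comp_mem_FP remFn_mem_FP (fanoutFn_mem_FP (const_mem_FP _) pF_mem_FP))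
      (comp_mem_FP remFn_mem_FP (fanoutFn_mem_FP hb pF_mem_FP)))))))

/-- The exponent of generator-trial `u` carried by the controls `c`: `∑_l 2^l #{ones in level l}`.
[cite: Kitaev1995, §3 Lemma 10 (the powers 2^l)] -/
def expoD (ℓ : ℕ) (c : List Bool) (u : ℕ) : ℕ := levelExp (2 * dlBlockSize ℓ) (dlNumLevels ℓ) (c.drop (u * genLenD ℓ))

/-- **Value of `powDF`** on a well-formed parsed input. [cite: Shor1997, §3 p.9] -/
theorem powF_prec {p : ℕ} (hp : 2 ≤ p) (g y : ℕ) (c : List Bool) (u : ℕ) {b : List Bool → List Bool} {bv : ℕ}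
    (hb : b (precD (encodeDLogInstance p g y).length (encodeDLogInstance p g y ++ c)) = encodeNat bv) :
    powDF u b (precD (encodeDLogInstance p g y).length (encodeDLogInstance p g y ++ c)) =
      encodeNat (bv ^ expoD (encodeDLogInstance p g y).length c u % p) := by
  have hloop := iterate_loopStep lvBodyD (boolPair (ones (encodeDLogInstance p g y).length) (encodeNat p))
    ((encodeDLogInstance p g y).length + 1)
    ((X : Polynomial ℕ).eval (boolPair (ones (encodeDLogInstance p g y).length) (encodeNat p)).length)
    (boolPair (c.drop (u * genLenD (encodeDLogInstance p g y).length)) (boolPair (encodeNat (1 % p)) (encodeNat (bv % p))))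
    (by simp only [eval_X, length_boolPair, List.length_replicate]; omega)
  rw [loopModel_lvBody hp, one_mul] at hloop
  have hx : xDF (precD (encodeDLogInstance p g y).length (encodeDLogInstance p g y ++ c)) =
      boolPair (ones (encodeDLogInstance p g y).length) (encodeNat p) := by
    rw [xDF, fanoutFn_apply, pF_prec]; simp [precD]
  have hcnt : (lenBinF ∘ List.cons true ∘ fstF) (precD (encodeDLogInstance p g y).length (encodeDLogInstance p g y ++ c)) =
      encodeNat ((encodeDLogInstance p g y).length + 1) := by
    simp [precD]
  have hr0 : (remFn ∘ fanoutFn (fun _ => [true]) pDF) (precD (encodeDLogInstance p g y).length (encodeDLogInstance p g y ++ c)) =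
      encodeNat (1 % p) := by
    rw [Function.comp_apply, fanoutFn_apply, pF_prec, remFn_boolPair, bitsToNat_encodeNat]
    simp
  have hP0 : (remFn ∘ fanoutFn b pDF) (precD (encodeDLogInstance p g y).length (encodeDLogInstance p g y ++ c)) =
      encodeNat (bv % p) := by
    rw [Function.comp_apply, fanoutFn_apply, hb, pF_prec, remFn_boolPair, bitsToNat_encodeNat, bitsToNat_encodeNat]
  rw [powDF, Function.comp_apply, Function.comp_apply, fanoutFn_apply, fanoutFn_apply, fanoutFn_apply, fanoutFn_apply,
    hx, hcnt, segUF_prec, hr0, hP0, lvLoopD, fstF_boolPair, hloop, expoD]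
  simp [show dlNumLevels (encodeDLogInstance p g y).length = (encodeDLogInstance p g y).length + 1 from rfl]

/-- **The residueD of trial `t`**: `(g^{E_{2t}} mod p)(y^{E_{2t+1}} mod p) mod p`. [cite: Shor1997, §6 p.16 (the register g^a x^-b mod p); Kitaev1995, §4 p.15] -/
def resTDF (t : ℕ) : List Bool → List Bool :=
  remFn ∘ fanoutFn (prodFn ∘ fanoutFn (powDF (2 * t) gDF) (powDF (2 * t + 1) yDF)) pDF

/-- `resTDF t ∈ FP`. [folklore] -/
theorem resTF_mem_FP (t : ℕ) : resTDF t ∈ FP :=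
  comp_mem_FP remFn_mem_FP (fanoutFn_mem_FP (comp_mem_FP prodFn_mem_FP
    (fanoutFn_mem_FP (powF_mem_FP _ gF_mem_FP) (powF_mem_FP _ yF_mem_FP))) pF_mem_FP)

/-- The residueD of trial `t` of the instance `(p, g, y)` with controls `c`. [cite: Shor1997, §6 p.16] -/
def residueD (p g y : ℕ) (c : List Bool) (t : ℕ) : ℕ :=
  g ^ expoD (encodeDLogInstance p g y).length c (2 * t) % p *
    (y ^ expoD (encodeDLogInstance p g y).length c (2 * t + 1) % p) % p

/-- **Value of `resTDF`.** [folklore] -/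
theorem resTF_prec {p : ℕ} (hp : 2 ≤ p) (g y : ℕ) (c : List Bool) (t : ℕ) :
    resTDF t (precD (encodeDLogInstance p g y).length (encodeDLogInstance p g y ++ c)) = encodeNat (residueD p g y c t) := by
  rw [resTDF, Function.comp_apply, fanoutFn_apply, Function.comp_apply, fanoutFn_apply,
    powF_prec hp g y c _ (gF_prec p g y c), powF_prec hp g y c _ (yF_prec p g y c), pF_prec]
  simp [residueD]

/-- **The output**: the coded list (`encList`) of the four residues. [folklore] -/
def outDF : List Bool → List Bool :=
  fanoutFn (resTDF 0) (fanoutFn (resTDF 1) (fanoutFn (resTDF 2) (fanoutFn (resTDF 3) (fun _ => []))))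

/-- `outDF ∈ FP`. [folklore] -/
theorem outF_mem_FP : outDF ∈ FP :=
  fanoutFn_mem_FP (resTF_mem_FP 0) (fanoutFn_mem_FP (resTF_mem_FP 1) (fanoutFn_mem_FP (resTF_mem_FP 2)
    (fanoutFn_mem_FP (resTF_mem_FP 3) (const_mem_FP _))))

/-- **The block function**: parse the instance length, then the four residues.
[cite: Shor1997, §3 pp.8–10 and §6 p.16; Kitaev1995, §4 p.15] -/
def blockFnD : List Bool → List Bool := outDF ∘ fanoutFn searchDF idF

/-- **`blockFnD ∈ FP`.** [cite: AroraBarak2009, §1.3 (closure of polynomial time under composition and bounded loops)] -/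
theorem blockFn_mem_FP : blockFnD ∈ FP := comp_mem_FP outF_mem_FP (fanoutFn_mem_FP searchF_mem_FP idF_mem_FP)

/-- **The block function on a well-formed data string** `w ++ c` (`w = encodeDLogInstance p g y`,
`p ≥ 2`, `|c| = dlNumControls |w|`): the coded list of the four residues
`(g^{E_{2t}} mod p)(y^{E_{2t+1}} mod p) mod p`. [cite: Shor1997, §6 p.16 (third register); Kitaev1995, §4 p.15 (two generators, l registers)] -/
theorem blockFn_wellFormed {p : ℕ} (hp : 2 ≤ p) (g y : ℕ) (c : List Bool)
    (hc : c.length = dlNumControls (encodeDLogInstance p g y).length) :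
    blockFnD (encodeDLogInstance p g y ++ c) = encList ((List.range 4).map fun t => encodeNat (residueD p g y c t)) := by
  have hz : (encodeDLogInstance p g y ++ c).length =
      (encodeDLogInstance p g y).length + dlNumControls (encodeDLogInstance p g y).length := by
    rw [List.length_append, hc]
  rw [blockFnD, Function.comp_apply, fanoutFn_apply, searchF_wellFormed _ hz, idF, ← precD]
  simp [outDF, resTF_prec hp, List.range_succ, encList]

/-! ### The block: the clean reversible compilation of `blockFnD` (after `ShorModExpBlock.lean`) -/

section Block

open QuantumComplexity QuantumComplexity.RevClean QuantumComplexity.RevSim Matrix Finset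

/-- A polynomial-time machine of `blockFnD` with a time bound of the shape `(n+2)^e`. [folklore] -/
theorem exists_blockMachine : ∃ q : (_ : ℕ) × Turing.TM2ComputableAux Bool Bool,
    ∀ u : List Bool, q.2.OutputsWithin u (blockFnD u) (Tn q.1 u.length) := by
  obtain ⟨e, M, h⟩ := exists_outputsWithin_pow_of_mem_FP blockFn_mem_FP
  exact ⟨⟨e, M⟩, h⟩

/-- The exponent of the time bound of the block machine. [folklore] -/
def eD : ℕ := (Classical.choose exists_blockMachine).1

/-- **The block machine** (a `TM2` machine computing `blockFnD` within `(n+2)^{eD}` steps). [folklore] -/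
def MD : Turing.TM2ComputableAux Bool Bool := (Classical.choose exists_blockMachine).2

/-- The block machine computes `blockFnD` within its time bound. [folklore] -/
theorem MB_outputsWithin (u : List Bool) : MD.OutputsWithin u (blockFnD u) (Tn eD u.length) :=
  Classical.choose_spec exists_blockMachine u

/-- Data wires (= tableau input, there is no suffix): the instance `w` and the controls `c`. [folklore] -/
def dataND (ℓ : ℕ) : ℕ := ℓ + dlNumControls ℓ

/-- The total number of wires of the block. [folklore] -/
def totND (ℓ : ℕ) : ℕ := width eD MD (dataND ℓ)

/-- The number of work wires of the block. [folklore] -/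
def mWD (ℓ : ℕ) : ℕ := totND ℓ - dataND ℓ

/-- The data wires lie before the work wires. [folklore] -/
theorem dataN_le_totN (ℓ : ℕ) : dataND ℓ ≤ totND ℓ := (le_NN (e := eD) (M := MD) (dataND ℓ)).trans (NN_le_width _)

/-- Kitaev's layout has the width of the block. [folklore] -/
theorem layoutN_eq (ℓ : ℕ) : ℓ + (dlNumControls ℓ + mWD ℓ) = totND ℓ := by
  have := dataN_le_totN ℓ; unfold mWD dataND at *; omega

/-- There is a wire. [folklore] -/
theorem layoutN_pos (ℓ : ℕ) : 0 < ℓ + (dlNumControls ℓ + mWD ℓ) := by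
  rw [layoutN_eq]; exact (NN_pos eD MD _).trans_le (NN_le_width _)

/-- The clean block on `ℕ`-indexed wires (no constant suffix). [cite: Shor1997, §3 p.8 (compute F(x) keeping x, copy, undo)] -/
def opsND (ℓ : ℕ) : List (ClOp ℕ) := cleanOps eD MD (dataND ℓ) []

/-- The block uses wires of the layout only. [folklore] -/
theorem opsN_lt (ℓ : ℕ) : ∀ op ∈ opsND ℓ, ∀ i ∈ wiresOf op, i < ℓ + (dlNumControls ℓ + mWD ℓ) := by
  rw [layoutN_eq]; exact cleanOps_lt

/-- The clean block on the wires of the layout. [folklore] -/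
def opsFinD (ℓ : ℕ) : List (ClOp (Fin (ℓ + (dlNumControls ℓ + mWD ℓ)))) :=
  (opsND ℓ).map (ClOp.map (finOf _ (layoutN_pos ℓ)))

/-- The re-indexed block is well formed. [folklore] -/
theorem opsFinB_wf (ℓ : ℕ) : ∀ op ∈ opsFinD ℓ, op.WF := by
  intro op hop
  simp only [opsFinD, List.mem_map] at hop
  obtain ⟨op, hop, rfl⟩ := hop
  exact wf_map_finOf _ (opsN_lt ℓ op hop) (cleanOps_wf op hop)

/-- **The double modular-exponentiation block of Kitaev's discrete-logarithm family**: the exact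
Clifford+T compilation of the clean reversible block of the machine of `blockFnD`.
[cite: Shor1997, §3 pp.8–10 and §6 p.16; Kitaev1995, §2.2 Lemma 1] -/
def VD (ℓ : ℕ) : QCircuit cliffordT (ℓ + (dlNumControls ℓ + mWD ℓ)) :=
  ⟨revCompile (toRevList (opsFinD ℓ) (opsFinB_wf ℓ))⟩

/-- The block is oracle-free. [folklore] -/
theorem VB_isOracleFree (ℓ : ℕ) : (VD ℓ).IsOracleFree := revCompile_isOracleFree _

/-- The tableau input of the block on instance `w` and controls `c`. [folklore] -/
def inpOfD (w : List Bool) (c : QReg (dlNumControls w.length)) : List Bool := w ++ List.ofFn c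

/-- The tableau input has length `dataND`. [folklore] -/
theorem length_inpOf (w : List Bool) (c : QReg (dlNumControls w.length)) : (inpOfD w c).length = dataND w.length := by
  simp [inpOfD, dataND]

/-- **The work register** of the block's output on `|w⟩|c⟩|0…0⟩`: the read-out code of
`blockFnD (w ++ c)` on the result wires, zeros elsewhere. [folklore] -/
def resOfD (w : List Bool) (c : QReg (dlNumControls w.length)) : QReg (mWD w.length) :=
  fun j => readOut eD MD (dataND w.length) (blockFnD (inpOfD w c)) (dataND w.length + j)

/-- **Semantics of the block on basis inputs**: `VD |w⟩|c⟩|0^{mWD}⟩ = |w⟩|c⟩|resOfD w c⟩`.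
[cite: Shor1997, §3 p.8 (compute F(x) keeping x, copy, undo); Kitaev1995, §2.2 Lemma 1] -/
theorem VB_mulVec_basisState (w : List Bool) (c : QReg (dlNumControls w.length)) :
    (VD w.length).toMatrix 0 *ᵥ basisState (coinInput w.get c) = basisState (tri w.get c (resOfD w c)) := by
  rw [VD, revCompile_mulVec_basisState]
  congr 1
  have hM := MB_outputsWithin (inpOfD w c)
  rw [length_inpOf, inpOfD] at hM
  have hM' : MD.OutputsWithin ((w ++ List.ofFn c) ++ []) (blockFnD (w ++ List.ofFn c))
      (Tn eD ((w ++ List.ofFn c).length + ([] : List Bool).length)) := by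
    rw [List.append_nil, List.length_nil, Nat.add_zero]
    rw [show dataND w.length = (w ++ List.ofFn c).length by simp [dataND]] at hM
    exact hM
  have key : ∀ q : Fin (w.length + (dlNumControls w.length + mWD w.length)),
      revEval (toRevList (opsFinD w.length) (opsFinB_wf w.length)) (coinInput w.get c) q =
        liftW (tri w.get c (resOfD w c)) q := by
    intro q
    rw [revEval_toRevList, opsFinD, clEval_map_finOf_apply _ _ (opsN_lt _), ModExpBlock.liftW_coinInput, opsND,
      show dataND w.length = (w ++ List.ofFn c).length by simp [dataND], clEval_cleanOps _ _ _ hM', ModExpBlock.liftW_tri]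
    dsimp only
    have hq := q.isLt
    by_cases h1 : (q : ℕ) < w.length
    · rw [if_pos (by simp; omega), dif_pos h1, List.getD_append _ _ _ _ h1, List.getD_eq_getElem _ _ h1]; rfl
    rw [dif_neg h1]
    by_cases h2 : (q : ℕ) < w.length + dlNumControls w.length
    · rw [if_pos (by simpa using h2), dif_pos h2, List.getD_append_right _ _ _ _ (not_lt.1 h1),
        List.getD_eq_getElem _ _ (by simp; omega), List.getElem_ofFn]
    · rw [if_neg (by simpa using h2), dif_neg h2, dif_pos hq, resOfD, inpOfD]
      simp only [List.length_append, List.length_ofFn, List.length_nil, Nat.add_zero, dataND]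
      congr 1
      omega
  funext q
  rw [key, liftW_val]

/-! ### Kitaev's weighted trial exponents are the Horner sums of the control stream -/

/-- **The exponent carried by the controls of tag `(t, η)` is the Horner sum of generator-trial
`u = 2t + η`**: `trialExp (dlTag ℓ) (dlExps ℓ) (t, η) c = expoD ℓ c (2t + η)`.
[cite: Kitaev1995, §3 (Lemma 10: the powers U^(2^l)) and §4 p.15 (two generators)] -/
theorem trialExp_eq_expo (ℓ : ℕ) (c : QReg (dlNumControls ℓ)) (t : Fin numTrials) (η : Bool) :
    trialExp (dlTag ℓ) (dlExps ℓ) (t, η) c = expoD ℓ (List.ofFn c) (2 * t + η.toNat) := by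
  classical
  -- the Horner sum, window by window
  rw [expoD, ModExpBlock.levelExp_eq_sum, sum_range]
  simp only [List.drop_drop, OFPostCF.count_take_drop_eq_sum]
  -- the trial sum, reindexed by the layout
  rw [trialExp, sum_filter, ← Equiv.sum_comp (dlLayout ℓ).symm]
  simp only [dlTag, dlTrialOf, dlGenOf, dlExps, dlLevelOf, Equiv.apply_symm_apply]
  rw [Fintype.sum_prod_type, Finset.sum_eq_single t (fun t' _ ht' => by simp [ht']) (by simp)]
  rw [Fintype.sum_prod_type, Finset.sum_eq_single η (fun η' _ hη' => by simp [hη']) (by simp)]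
  simp only [if_true]
  rw [Fintype.sum_prod_type]
  dsimp only
  refine sum_congr rfl fun l _ => ?_
  rw [Fintype.sum_prod_type, mul_sum,
    ModExpBlock.sum_fin_two_mul (f := fun i => 2 ^ (l : ℕ) *
      ((List.ofFn c).getD ((2 * ↑t + η.toNat) * genLenD ℓ + ↑l * (2 * dlBlockSize ℓ) + i) false).toNat),
    Fintype.sum_prod_type]
  refine sum_congr rfl fun τ _ => sum_congr rfl fun i _ => ?_
  rw [Nat.mul_comm (2 ^ (l : ℕ))]
  congr 2
  have hv := val_dlLayout_symm t η l τ i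
  have hoff : dlOff ℓ (2 * ↑t + η.toNat) l τ =
      (2 * ↑t + η.toNat) * genLenD ℓ + ↑l * (2 * dlBlockSize ℓ) + τ.toNat * dlBlockSize ℓ := by
    unfold dlOff genLenD dlNumLevels; ring
  have hlt : dlOff ℓ (2 * ↑t + η.toNat) l τ + i < dlNumControls ℓ := hv ▸ ((dlLayout ℓ).symm (t, η, l, τ, i)).isLt
  rw [hoff] at hlt
  rw [List.getD_eq_getElem _ _ (by simp; omega), List.getElem_ofFn]
  congr 1
  ext
  rw [hv, hoff]
  ring

/-! ### The work register determines and is determined by the residues -/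

/-- **The block machine on the block's tableau input** writes the coded list of the four
residues. [cite: Shor1997, §6 p.16] -/
theorem blockFn_inpOf {p g y : ℕ} (hp : 2 ≤ p) (c : QReg (dlNumControls (encodeDLogInstance p g y).length)) :
    blockFnD (inpOfD (encodeDLogInstance p g y) c) =
      encList ((List.range 4).map fun t => encodeNat (residueD p g y (List.ofFn c) t)) :=
  blockFn_wellFormed hp g y (List.ofFn c) (by simp)

/-- The whole read-out of the block's output is determined by the work register. [folklore] -/
theorem readOut_eq_of_resOf_eq {w : List Bool} {c c' : QReg (dlNumControls w.length)} (h : resOfD w c = resOfD w c') :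
    readOut eD MD (dataND w.length) (blockFnD (inpOfD w c)) = readOut eD MD (dataND w.length) (blockFnD (inpOfD w c')) := by
  funext i
  have hwid : totND w.length = NN eD MD (dataND w.length) + copyN eD MD (dataND w.length) := rfl
  have hNN : dataND w.length ≤ NN eD MD (dataND w.length) := le_NN _
  by_cases h1 : i < dataND w.length
  · rw [readOut, readOut, if_neg (by omega), if_neg (by omega)]
  · by_cases h2 : i < totND w.length
    · have := congrFun h ⟨i - dataND w.length, by unfold mWD; omega⟩
      simp only [resOfD] at this
      rwa [show dataND w.length + (i - dataND w.length) = i by omega] at this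
    · rw [readOut, readOut, if_neg (by omega), if_neg (by omega)]

/-- The residueD of trial `t` is `g^{A_t} y^{B_t} mod p` for Kitaev's weighted trial exponents.
[cite: Kitaev1995, §4 p.15 (two generators V_1, V_2)] -/
theorem residue_eq (p g y : ℕ) (c : QReg (dlNumControls (encodeDLogInstance p g y).length)) (t : Fin numTrials) :
    residueD p g y (List.ofFn c) t =
      g ^ trialExp (dlTag _) (dlExps _) (t, false) c * y ^ trialExp (dlTag _) (dlExps _) (t, true) c % p := by
  rw [residueD, trialExp_eq_expo, trialExp_eq_expo, ← Nat.mul_mod]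
  simp

/-- **The work register determines and is determined by the residues** `g^{A_t} y^{B_t} mod p`.
[cite: Shor1997, §6 p.16 (the register g^a x^-b mod p, no garbage by §3); Kitaev1995, §2.2 Lemma 1] -/
theorem resOf_eq_iff {p g y : ℕ} (hp : 2 ≤ p) (c c' : QReg (dlNumControls (encodeDLogInstance p g y).length)) :
    resOfD (encodeDLogInstance p g y) c = resOfD (encodeDLogInstance p g y) c' ↔
      ∀ t, g ^ trialExp (dlTag _) (dlExps _) (t, false) c * y ^ trialExp (dlTag _) (dlExps _) (t, true) c ≡
        g ^ trialExp (dlTag _) (dlExps _) (t, false) c' * y ^ trialExp (dlTag _) (dlExps _) (t, true) c' [MOD p] := by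
  constructor
  · intro h t
    have hro := readOut_eq_of_resOf_eq h
    have h₁ := MB_outputsWithin (inpOfD (encodeDLogInstance p g y) c)
    have h₂ := MB_outputsWithin (inpOfD (encodeDLogInstance p g y) c')
    rw [length_inpOf] at h₁ h₂
    have hl := eq_of_readOut_eq (length_inpOf _ c) (length_inpOf _ c') h₁ h₂ hro
    rw [blockFn_inpOf hp c, blockFn_inpOf hp c'] at hl
    have hl' := List.map_eq_map_iff.1 (ModExpBlock.encList_injective hl) t (List.mem_range.2 t.isLt)
    have heq : residueD p g y (List.ofFn c) t = residueD p g y (List.ofFn c') t := QCircuit.encodeNat_injective hl'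
    rw [Nat.ModEq, ← residue_eq, ← residue_eq, heq]
  · intro h
    have hl : blockFnD (inpOfD (encodeDLogInstance p g y) c) = blockFnD (inpOfD (encodeDLogInstance p g y) c') := by
      rw [blockFn_inpOf hp c, blockFn_inpOf hp c']
      refine congrArg encList (List.map_congr_left fun t ht => ?_)
      have ht4 : t < numTrials := List.mem_range.1 ht
      have := h ⟨t, ht4⟩
      rw [Nat.ModEq, ← residue_eq, ← residue_eq] at this
      exact congrArg encodeNat this
    funext j
    change readOut eD MD _ (blockFnD (inpOfD _ c)) _ = readOut eD MD _ (blockFnD (inpOfD _ c')) _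
    rw [hl]

/-! ### The named programming fact and the reduction of `Kitaev1995_dlogFamily` to it -/

/-- **Named programming fact: Kitaev's discrete-logarithm family around the double
modular-exponentiation block is polynomial-time uniform** — the description of
`kitaevDLogFamily mWD VD` (header; a Hadamard gate on each control wire; the clean block
`cleanOps`: the tableau of `MD` forwards, the read-out fan-out, the tableau backwards, each gate an
exact Clifford+T word; `S³` on the sine-test control wires; the Hadamard layer again) is printed
from `1^ℓ` in polynomial time (Shor 1997, §2, p. 7: "the design of the gate array be produced by a
polynomial-time (classical) computation"; Kitaev 1995, §4, p. 15: "our procedure is uniform"; the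
generator toolkit of `RevTableauUniform.lean`/`RevUncomputeUniform.lean`/`CleanBlockDesc.lean`, and
the twin `ModExpBlock.kitaevModExpFamily_isUniform` of the order-finding family).
[cite: Shor1997, §2 p.7 (uniformity of the gate array); Kitaev1995, §4 p.15] -/
def kitaevDLogBlockFamily_isUniform : Prop := (kitaevDLogFamily mWD VD).IsUniform

/-- **`Kitaev1995_dlogFamily` from the programming fact**: the family around the block `VD` is
oracle-free (`VB_isOracleFree`), uniform by hypothesis, and on every instance (`p` prime, so
`p ≥ 2`) the block maps `|w⟩|c⟩|0^{mWD}⟩` to `|w⟩|c⟩|resOfD w c⟩` (`VB_mulVec_basisState`) with a work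
register that determines and is determined by the residues `g^{A_t} y^{B_t} mod p`
(`resOf_eq_iff`). [cite: Shor1997, §6 p.16 and §3 p.8; Kitaev1995, §2.2 Lemma 1 and §4 p.15] -/
theorem _root_.Literature.Computability.Cryptography.Kitaev1995_dlogFamily_of
    (h : kitaevDLogBlockFamily_isUniform) : Kitaev1995_dlogFamily :=
  ⟨mWD, VD, VB_isOracleFree, h, fun p g y hinst =>
    ⟨resOfD (encodeDLogInstance p g y), fun c => VB_mulVec_basisState _ c,
      fun c c' => resOf_eq_iff hinst.1.two_le c c'⟩⟩

end Block

end DLogBlock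

end Kitaev1995

end Literature.Computability.Cryptography

end
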